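import Summits.Ventures.HodgeRepro2.T5SU11SphericalDecayOriginFlux
import Summits.Ventures.HodgeRepro2.T5SU11ResolventConstantSource

/-!
# The integrated radial equation of the decaying solution from the origin:
`sinh 2t · χ_λ′(t) = −1 + μ ∫_0^t χ_λ sinh 2s ds`, and `χ_λ` is strictly decreasing

The flux `F(t) = sinh 2t · χ_λ′(t)` satisfies `F′ = μ sinh 2t · χ_λ` (the radial equation in divergence form) and `F(0⁺) = −1`
(row 633). Integrating from the singular endpoint:

* `hasDerivAt_sinh_mul_sphDecay'` — `F′(t) = μ sinh 2t χ_λ(t)` on `(0, ∞)`;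
* `integrableOn_sphDecay_mul_sinh_Ioc` — `χ_λ sinh 2s` is integrable on every `(0, T]`;
* `sinh_mul_sphDecay'_eq` — **`sinh 2t · χ_λ′(t) = −1 + μ ∫_{(0,t]} χ_λ(s) sinh 2s ds`** for every `t > 0` (the improper fundamental
  theorem of calculus at the endpoint `0`);
* `sphDecay'_neg` — **`χ_λ′(t) < 0`** for every `t > 0`: for `μ ≤ 0` the flux stays `≤ −1`; for `μ > 0` (`λ > 2`) the flux increases
  strictly to its limit `0` at infinity (row 544's `sinh 2R χ_λ′(R) → 0`), hence is negative throughout;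
* `sphDecay_strictAntiOn` — **THE DECAYING SOLUTION IS STRICTLY DECREASING ON `(0, ∞)`** for every `λ > 1`.

Nothing is claimed about (N).

Blind lane: Mathlib + the HodgeRepro2 prefix only; no sorry; axioms ⊆ {propext, Classical.choice,
Quot.sound}.
-/

namespace Summit.Ventures.HodgeRepro2.T5SU11SphericalDecayFluxIdentity

open Filter Topology MeasureTheory intervalIntegral
open Set (Ioi Ioc Icc uIcc)
open T5SU11Cartan T5SU11SphericalFunction T5SU11SphericalBounds T5SU11SphericalContinuous T5SU11SphericalDecay
  T5SU11ReductionOfOrder T5SU11RadialGreenImproperDecaySource T5SU11ResolventConstantSource T5SU11ResolventOrigin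
  T5SU11SphericalDecayOriginFlux

section measure

/-- `∫_{(0,ε]} h → 0` as `ε → 0⁺` for `h` integrable on some `(0, T]`, `T > 0` (row 625 on the truncation). -/
theorem tendsto_setIntegral_Ioc_nhdsGT_zero_of_Ioc {h : ℝ → ℝ} {T : ℝ} (hT : 0 < T) (hint : IntegrableOn h (Ioc 0 T)) :
    Tendsto (fun ε => ∫ s in Ioc 0 ε, h s) (𝓝[>] 0) (𝓝 0) := by
  have hind : IntegrableOn (Set.indicator (Ioc 0 T) h) (Ioi 0) :=
    (hint.integrable_indicator measurableSet_Ioc).integrableOn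
  refine (tendsto_setIntegral_Ioc_nhdsGT_zero hind).congr' ?_
  filter_upwards [Ioo_mem_nhdsGT hT] with ε hε
  apply setIntegral_congr_fun measurableSet_Ioc
  intro s hs
  have hmem : s ∈ Ioc 0 T := ⟨hs.1, le_trans hs.2 hε.2.le⟩
  exact Set.indicator_of_mem hmem h

variable [MeasurableSpace Circle] [BorelSpace Circle]

variable {lam : ℝ} (hlam : 1 < lam)

include hlam in
/-- **`(sinh 2t · χ_λ′)′ = μ sinh 2t · χ_λ`** on `(0, ∞)`: the radial equation in divergence form. -/
theorem hasDerivAt_sinh_mul_sphDecay' {t : ℝ} (ht : 0 < t) :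
    HasDerivAt (fun t => Real.sinh (2 * t) * sphDecay' lam t)
      (lam * (lam - 2) * Real.sinh (2 * t) * sphDecay lam t) t := by
  have h1 : HasDerivAt (fun t => Real.sinh (2 * t)) (Real.cosh (2 * t) * (2 * 1)) t :=
    ((hasDerivAt_id' t).const_mul 2).sinh
  have h := h1.mul (hasDerivAt_sphDecay' lam ht)
  have e : lam * (lam - 2) * Real.sinh (2 * t) * sphDecay lam t
      = Real.cosh (2 * t) * (2 * 1) * sphDecay' lam t + Real.sinh (2 * t) * sphDecay'' lam t := by
    rw [← sphDecay_ode hlam ht]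
    ring
  rw [e]
  exact h

include hlam in
/-- `χ_λ sinh 2s` is integrable on every `(0, T]`. -/
theorem integrableOn_sphDecay_mul_sinh_Ioc (T : ℝ) :
    IntegrableOn (fun s => sphDecay lam s * Real.sinh (2 * s)) (Ioc 0 T) := by
  have hg : ContinuousOn (fun _ : ℝ => (1 : ℝ)) (Ioi 0) := continuousOn_const
  have hM : ∀ s ∈ Ioc (0 : ℝ) 1, |(fun _ : ℝ => (1 : ℝ)) s| ≤ 1 := fun s _ => by simp
  have hI1 := integrableOn_sphDecay_mul_mul_sinh_Ioc_one hlam hg hM zero_le_one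
  simp only [mul_one] at hI1
  have hcont : ContinuousOn (fun s => sphDecay lam s * Real.sinh (2 * s)) (Ioi 0) := by
    have hχ : ContinuousOn (sphDecay lam) (Ioi 0) :=
      fun t ht => (hasDerivAt_sphDecay hlam ht).continuousAt.continuousWithinAt
    exact hχ.mul (Real.continuous_sinh.comp (continuous_const.mul continuous_id)).continuousOn
  have hI2 : IntegrableOn (fun s => sphDecay lam s * Real.sinh (2 * s)) (Ioc 1 T) :=
    ((hcont.mono (fun s hs => lt_of_lt_of_le one_pos hs.1)).integrableOn_Icc).mono_set Set.Ioc_subset_Icc_self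
  rcases le_or_gt 1 T with h1T | h1T
  · have := hI1.union hI2
    rwa [Set.Ioc_union_Ioc_eq_Ioc zero_le_one h1T] at this
  · exact hI1.mono_set (Set.Ioc_subset_Ioc_right h1T.le)

include hlam in
/-- **THE INTEGRATED RADIAL EQUATION FROM THE ORIGIN**: `sinh 2t · χ_λ′(t) = −1 + μ ∫_{(0,t]} χ_λ(s) sinh 2s ds` for `t > 0`. -/
theorem sinh_mul_sphDecay'_eq {t : ℝ} (ht : 0 < t) :
    Real.sinh (2 * t) * sphDecay' lam t
      = -1 + lam * (lam - 2) * ∫ s in Ioc 0 t, sphDecay lam s * Real.sinh (2 * s) := by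
  set F : ℝ → ℝ := fun t => Real.sinh (2 * t) * sphDecay' lam t with hF
  set h : ℝ → ℝ := fun s => lam * (lam - 2) * (sphDecay lam s * Real.sinh (2 * s)) with hh
  have hint : IntegrableOn h (Ioc 0 t) := (integrableOn_sphDecay_mul_sinh_Ioc hlam t).const_mul _
  -- the fundamental theorem of calculus on `[ε, t]`
  have hftc : ∀ ε, 0 < ε → ε ≤ t → F t - F ε = ∫ s in Ioc ε t, h s := by
    intro ε hε hεt
    have h1 : ∀ x ∈ uIcc ε t, HasDerivAt F (h x) x := by
      intro x hx
      rw [Set.uIcc_of_le hεt] at hx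
      have hx0 : 0 < x := lt_of_lt_of_le hε hx.1
      have := hasDerivAt_sinh_mul_sphDecay' hlam hx0
      simp only [hh]
      convert this using 1
      ring
    have h2 : IntervalIntegrable h volume ε t :=
      (intervalIntegrable_iff_integrableOn_Ioc_of_le hεt).mpr (hint.mono_set (Set.Ioc_subset_Ioc_left hε.le))
    rw [← integral_eq_sub_of_hasDerivAt h1 h2, integral_of_le hεt]
  -- let `ε → 0⁺`: `F ε → −1` and `∫_{(ε,t]} h → ∫_{(0,t]} h`
  have hsplit : ∀ ε, 0 < ε → ε ≤ t → ∫ s in Ioc ε t, h s = (∫ s in Ioc 0 t, h s) - ∫ s in Ioc 0 ε, h s := by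
    intro ε hε hεt
    have hu : Ioc 0 ε ∪ Ioc ε t = Ioc 0 t := Set.Ioc_union_Ioc_eq_Ioc hε.le hεt
    have hd : Disjoint (Ioc 0 ε) (Ioc ε t) := Set.Ioc_disjoint_Ioc_of_le le_rfl
    have := setIntegral_union hd measurableSet_Ioc (hint.mono_set (Set.Ioc_subset_Ioc_right hεt))
      (hint.mono_set (Set.Ioc_subset_Ioc_left hε.le))
    rw [hu] at this
    rw [this]
    ring
  have hlimF : Tendsto F (𝓝[>] 0) (𝓝 (-1)) := tendsto_sinh_mul_sphDecay'_nhdsGT_zero hlam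
  have hlimI : Tendsto (fun ε => ∫ s in Ioc 0 ε, h s) (𝓝[>] 0) (𝓝 0) :=
    tendsto_setIntegral_Ioc_nhdsGT_zero_of_Ioc ht hint
  -- `F t = F ε + ∫_{(ε,t]} h` for all small `ε`; pass to the limit
  have hconst : Tendsto (fun ε => F ε + ((∫ s in Ioc 0 t, h s) - ∫ s in Ioc 0 ε, h s)) (𝓝[>] 0)
      (𝓝 (-1 + ((∫ s in Ioc 0 t, h s) - 0))) :=
    hlimF.add (tendsto_const_nhds.sub hlimI)
  have heq : ∀ᶠ ε in 𝓝[>] (0 : ℝ), F ε + ((∫ s in Ioc 0 t, h s) - ∫ s in Ioc 0 ε, h s) = F t := by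
    filter_upwards [Ioo_mem_nhdsGT ht] with ε hε
    rw [← hsplit ε hε.1 hε.2.le, ← hftc ε hε.1 hε.2.le]
    ring
  have := tendsto_nhds_unique (hconst.congr' heq) tendsto_const_nhds
  rw [sub_zero] at this
  have hI : ∫ s in Ioc 0 t, h s = lam * (lam - 2) * ∫ s in Ioc 0 t, sphDecay lam s * Real.sinh (2 * s) := by
    simp only [hh]
    rw [MeasureTheory.integral_const_mul]
  rw [← hI]
  exact this.symm

include hlam in
/-- **`χ_λ′(t) < 0`** for every `t > 0`. -/
theorem sphDecay'_neg {t : ℝ} (ht : 0 < t) : sphDecay' lam t < 0 := by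
  have hs : 0 < Real.sinh (2 * t) := sinh_two_mul_pos ht
  suffices h : Real.sinh (2 * t) * sphDecay' lam t < 0 by
    by_contra hcon
    have hcon' : 0 ≤ sphDecay' lam t := not_lt.mp hcon
    exact absurd h (not_lt.mpr (mul_nonneg hs.le hcon'))
  rcases le_or_gt (lam * (lam - 2)) 0 with hμ | hμ
  · -- `μ ≤ 0`: the flux stays `≤ −1`
    rw [sinh_mul_sphDecay'_eq hlam ht]
    have hI : 0 ≤ ∫ s in Ioc 0 t, sphDecay lam s * Real.sinh (2 * s) :=
      setIntegral_nonneg measurableSet_Ioc fun s hs => by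
        have hs0 : 0 < s := (Set.mem_Ioc.mp hs).1
        exact mul_nonneg (sphDecay_pos hlam hs0).le (sinh_two_mul_pos hs0).le
    nlinarith
  · -- `μ > 0` (`λ > 2`): the flux increases strictly to `0`
    have h2 : 2 < lam := by
      by_contra hcon
      have hcon' : lam ≤ 2 := not_lt.mp hcon
      have : lam * (lam - 2) ≤ 0 := mul_nonpos_of_nonneg_of_nonpos (by linarith) (by linarith)
      linarith
    set F : ℝ → ℝ := fun t => Real.sinh (2 * t) * sphDecay' lam t with hF
    have hmono : StrictMonoOn F (Ioi 0) := by
      refine strictMonoOn_of_deriv_pos (convex_Ioi 0) ?_ ?_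
      · intro x hx
        exact (hasDerivAt_sinh_mul_sphDecay' hlam hx).continuousAt.continuousWithinAt
      · intro x hx
        rw [interior_Ioi] at hx
        rw [(hasDerivAt_sinh_mul_sphDecay' hlam hx).deriv]
        exact mul_pos (mul_pos hμ (sinh_two_mul_pos hx)) (sphDecay_pos hlam hx)
    have hlim : Tendsto F atTop (𝓝 0) := tendsto_sinh_mul_sphDecay'_atTop hlam h2
    by_contra hcon
    have hcon' : 0 ≤ F t := not_lt.mp hcon
    -- `F (t+1) > F t ≥ 0`, while `F → 0`: contradiction
    have hlt : F t < F (t + 1) := hmono ht (by simp only [Set.mem_Ioi]; linarith) (by linarith)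
    have hev : ∀ᶠ R in atTop, F R < F (t + 1) :=
      hlim.eventually (gt_mem_nhds (by linarith))
    obtain ⟨R, hR⟩ := (hev.and (eventually_ge_atTop (t + 1))).exists
    have : F (t + 1) ≤ F R := hmono.monotoneOn (by simp only [Set.mem_Ioi]; linarith)
      (by simp only [Set.mem_Ioi]; linarith) hR.2
    linarith [hR.1, hcon']

include hlam in
/-- **THE DECAYING SOLUTION IS STRICTLY DECREASING ON `(0, ∞)`**. -/
theorem sphDecay_strictAntiOn : StrictAntiOn (sphDecay lam) (Ioi 0) := by
  refine strictAntiOn_of_deriv_neg (convex_Ioi 0) ?_ ?_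
  · intro x hx
    exact (hasDerivAt_sphDecay hlam hx).continuousAt.continuousWithinAt
  · intro x hx
    rw [interior_Ioi] at hx
    rw [(hasDerivAt_sphDecay hlam hx).deriv]
    exact sphDecay'_neg hlam hx

end measure

end Summit.Ventures.HodgeRepro2.T5SU11SphericalDecayFluxIdentity
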